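import Mathlib
import Literature.NumberTheory.Transcendental.SemialgebraicMapsProofs

/-!
# Semantic first-order bookkeeping for `k`-semialgebraic sets indexed by finite types

Support file for item stmt-KontsevichZagierPeriods-5830 (`CircleSquaringImpossible`, route
DefinableMoves). The proof of that item is a parameter-free definability (Tarski transfer)
argument; this file provides the purely formal toolkit used to certify that a set described by a
first-order condition over `(ℝ, +, ·, <)` with rational coefficients is `ℚ`-semialgebraic, in the
tree's semantic setting `Literature.ModelTheory.ExponentialFields.IsSemialgebraic k` on tuple spaces
`ι → ℝ` indexed by arbitrary FINITE types (sums and products of `Fin n`), so that bound variables of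
different sorts can be kept in separate summands and accessed through `Sum.elim`:

* `IsSemialgebraic.image_comp_fintype` — images under coordinate maps `w ↦ w ∘ θ` for any map of
  finite index types (Tarski–Seidenberg, from the tree's `IsSemialgebraic.image_comp`);
* `IsSemialgebraic.exists_sum` / `forall_sum` — `{u | ∃ v, Sum.elim u v ∈ W}`, `{u | ∀ v, …}`;
* `IsSemialgebraic.imp`, `and`, `forall_index`, `exists_index` — propositional / finite-index connectives;
* `isSemialgebraic_setOf_eq/lt/le` — atomic polynomial (in)equalities `{v | f v ⋈ g v}` given polynomial
  certificates for `f`, `g`.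

## Real semialgebraic sets are fibres of `ℚ`-semialgebraic families

The "template" step of the argument: every `ℝ`-semialgebraic subset `A ⊆ ℝ ^ ι` is the fibre, at
some real parameter `c ∈ ℝ ^ γ` (`γ` a finite type), of a `ℚ`-semialgebraic subset
`A' ⊆ ℝ ^ (γ ⊕ ι)`: `x ∈ A ↔ Sum.elim c x ∈ A'` (`IsSemialgebraic.exists_rat_family`). Proof:
induction over the Boolean algebra; for a generator `{p = 0}` / `{p > 0}`, `p ∈ ℝ[Xᵢ]`, the
parameters are the coefficients of `p` and `A'` is cut out by the generic polynomial
`∑ₘ Cₘ · Xᵐ ∈ ℚ[Cₘ, Xᵢ]`; unions concatenate the parameter tuples ("every semialgebraic set is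
definable with parameters by a parameter-free formula").

All statements are folklore (Bochnak–Coste–Roy 1998, §§2.1–2.2; Basu–Pollack–Roy 2006, §2.5). The
lemmas named `IsSemialgebraic.*` are dot-notation extensions of the Literature predicate
`Literature.ModelTheory.ExponentialFields.IsSemialgebraic`, declared with absolute names.
-/

noncomputable section

open Set MvPolynomial

namespace Summit.KontsevichZagierPeriods.DefinableMoves.CircleSquaring

open Literature.ModelTheory.ExponentialFields

variable {k : Type*} [CommRing k] [Algebra k ℝ]

/-- **Images under coordinate maps between finite index types.** For finite index types `ι`, `κ`
and any `θ : ι → κ`, the image of a `k`-semialgebraic `W ⊆ ℝ ^ κ` under `w ↦ w ∘ θ` is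
`k`-semialgebraic (transport of the tree's `IsSemialgebraic.image_comp` along enumerations of the
index types; Tarski–Seidenberg). [folklore] -/
theorem _root_.Literature.ModelTheory.ExponentialFields.IsSemialgebraic.image_comp_fintype
    {ι κ : Type*} [Fintype ι] [Fintype κ] (θ : ι → κ) {W : Set (κ → ℝ)}
    (hW : IsSemialgebraic k W) :
    IsSemialgebraic k ((fun w : κ → ℝ => w ∘ θ) '' W) := by
  classical
  set eι := Fintype.equivFin ι
  set eκ := Fintype.equivFin κ
  have h1 : IsSemialgebraic k ((fun v : Fin (Fintype.card κ) → ℝ => v ∘ eκ) ⁻¹' W) :=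
    hW.preimage_comp eκ
  have h2 := h1.image_comp (eκ ∘ θ ∘ eι.symm)
  have h3 := h2.preimage_comp (ι := ι) eι.symm
  convert h3 using 1
  ext y
  simp only [mem_preimage, mem_image]
  constructor
  · rintro ⟨w, hw, rfl⟩
    refine ⟨w ∘ eκ.symm, ?_, ?_⟩
    · show (w ∘ eκ.symm) ∘ eκ ∈ W
      convert hw using 1
      funext j
      simp
    · funext i
      simp
  · rintro ⟨v, hv, hyv⟩
    refine ⟨v ∘ eκ, hv, ?_⟩
    funext i
    have := congr_fun hyv (eι i)
    simp only [Function.comp_apply, Equiv.symm_apply_apply] at this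
    simpa using this

/-- **Existential projection along a summand.** If `W ⊆ ℝ ^ (α ⊕ β)` is `k`-semialgebraic then so
is `{u ∈ ℝ ^ α | ∃ v ∈ ℝ ^ β, (u, v) ∈ W}` (Tarski–Seidenberg). [folklore] -/
theorem _root_.Literature.ModelTheory.ExponentialFields.IsSemialgebraic.exists_sum
    {α β : Type*} [Fintype α] [Fintype β] {W : Set (α ⊕ β → ℝ)} (hW : IsSemialgebraic k W) :
    IsSemialgebraic k {u : α → ℝ | ∃ v : β → ℝ, Sum.elim u v ∈ W} := by
  convert hW.image_comp_fintype Sum.inl using 1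
  ext u
  simp only [mem_setOf_eq, mem_image]
  constructor
  · rintro ⟨v, hv⟩
    exact ⟨Sum.elim u v, hv, Sum.elim_comp_inl u v⟩
  · rintro ⟨w, hw, rfl⟩
    exact ⟨w ∘ Sum.inr, by rw [Sum.elim_comp_inl_inr]; exact hw⟩

/-- **Existential projection along the first summand.** If `W ⊆ ℝ ^ (α ⊕ β)` is
`k`-semialgebraic then so is `{v ∈ ℝ ^ β | ∃ u ∈ ℝ ^ α, (u, v) ∈ W}` (Tarski–Seidenberg). [folklore] -/
theorem _root_.Literature.ModelTheory.ExponentialFields.IsSemialgebraic.exists_sum_left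
    {α β : Type*} [Fintype α] [Fintype β] {W : Set (α ⊕ β → ℝ)} (hW : IsSemialgebraic k W) :
    IsSemialgebraic k {v : β → ℝ | ∃ u : α → ℝ, Sum.elim u v ∈ W} := by
  convert hW.image_comp_fintype Sum.inr using 1
  ext v
  simp only [mem_setOf_eq, mem_image]
  constructor
  · rintro ⟨u, hu⟩
    exact ⟨Sum.elim u v, hu, Sum.elim_comp_inr u v⟩
  · rintro ⟨w, hw, rfl⟩
    exact ⟨w ∘ Sum.inl, by rw [Sum.elim_comp_inl_inr]; exact hw⟩

/-- **Universal projection along a summand.** If `W ⊆ ℝ ^ (α ⊕ β)` is `k`-semialgebraic then so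
is `{u ∈ ℝ ^ α | ∀ v ∈ ℝ ^ β, (u, v) ∈ W}` (complement, project, complement). [folklore] -/
theorem _root_.Literature.ModelTheory.ExponentialFields.IsSemialgebraic.forall_sum
    {α β : Type*} [Fintype α] [Fintype β] {W : Set (α ⊕ β → ℝ)} (hW : IsSemialgebraic k W) :
    IsSemialgebraic k {u : α → ℝ | ∀ v : β → ℝ, Sum.elim u v ∈ W} := by
  convert (hW.compl.exists_sum).compl using 1
  ext u
  simp

/-- Implications of semialgebraic conditions are semialgebraic. [folklore] -/
theorem _root_.Literature.ModelTheory.ExponentialFields.IsSemialgebraic.imp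
    {ι : Type*} {A B : Set (ι → ℝ)} (hA : IsSemialgebraic k A) (hB : IsSemialgebraic k B) :
    IsSemialgebraic k {v : ι → ℝ | v ∈ A → v ∈ B} := by
  convert hA.compl.union hB using 1
  ext v
  simp [imp_iff_not_or]

/-- Conjunctions of semialgebraic conditions are semialgebraic (definitionally `A ∩ B`). [folklore] -/
theorem _root_.Literature.ModelTheory.ExponentialFields.IsSemialgebraic.and
    {ι : Type*} {A B : Set (ι → ℝ)} (hA : IsSemialgebraic k A) (hB : IsSemialgebraic k B) :
    IsSemialgebraic k {v : ι → ℝ | v ∈ A ∧ v ∈ B} :=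
  hA.inter hB

/-- Universal quantification over a FINITE index type (a finite intersection). [folklore] -/
theorem _root_.Literature.ModelTheory.ExponentialFields.IsSemialgebraic.forall_index
    {ι : Type*} {σ : Type*} [Fintype σ] {A : σ → Set (ι → ℝ)}
    (hA : ∀ i, IsSemialgebraic k (A i)) :
    IsSemialgebraic k {v : ι → ℝ | ∀ i, v ∈ A i} := by
  classical
  convert IsSemialgebraic.biInter (Finset.univ : Finset σ) A (fun i _ => hA i) using 1
  ext v
  simp

/-- Existential quantification over a FINITE index type (a finite union). [folklore] -/
theorem _root_.Literature.ModelTheory.ExponentialFields.IsSemialgebraic.exists_index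
    {ι : Type*} {σ : Type*} [Fintype σ] {A : σ → Set (ι → ℝ)}
    (hA : ∀ i, IsSemialgebraic k (A i)) :
    IsSemialgebraic k {v : ι → ℝ | ∃ i, v ∈ A i} := by
  classical
  convert IsSemialgebraic.biUnion (Finset.univ : Finset σ) A (fun i _ => hA i) using 1
  ext v
  simp

/-! ### Atomic conditions with polynomial certificates -/

/-- `{v | f v = g v}` is `k`-semialgebraic when `f`, `g` are given by polynomials over `k`. [folklore] -/
theorem isSemialgebraic_setOf_eq {ι : Type*} {f g : (ι → ℝ) → ℝ} (P Q : MvPolynomial ι k)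
    (hP : ∀ v, aeval v P = f v) (hQ : ∀ v, aeval v Q = g v) :
    IsSemialgebraic k {v : ι → ℝ | f v = g v} := by
  convert isSemialgebraic_setOf_eval_eq_zero (k := k) (R := ℝ) (P - Q) using 1
  ext v
  simp only [mem_setOf_eq, map_sub, hP, hQ, sub_eq_zero]

/-- `{v | f v < g v}` is `k`-semialgebraic when `f`, `g` are given by polynomials over `k`. [folklore] -/
theorem isSemialgebraic_setOf_lt {ι : Type*} {f g : (ι → ℝ) → ℝ} (P Q : MvPolynomial ι k)
    (hP : ∀ v, aeval v P = f v) (hQ : ∀ v, aeval v Q = g v) :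
    IsSemialgebraic k {v : ι → ℝ | f v < g v} := by
  have h := isSemialgebraic_setOf_eval_lt (k := k) (R := ℝ) P Q
  have hs : {v : ι → ℝ | f v < g v} = {x | aeval x P < aeval x Q} := by
    ext v
    simp only [mem_setOf_eq, hP, hQ]
  rw [hs]
  exact h

/-- `{v | f v ≤ g v}` is `k`-semialgebraic when `f`, `g` are given by polynomials over `k`. [folklore] -/
theorem isSemialgebraic_setOf_le {ι : Type*} {f g : (ι → ℝ) → ℝ} (P Q : MvPolynomial ι k)
    (hP : ∀ v, aeval v P = f v) (hQ : ∀ v, aeval v Q = g v) :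
    IsSemialgebraic k {v : ι → ℝ | f v ≤ g v} := by
  have h := isSemialgebraic_setOf_eval_le (k := k) (R := ℝ) P Q
  have hs : {v : ι → ℝ | f v ≤ g v} = {x | aeval x P ≤ aeval x Q} := by
    ext v
    simp only [mem_setOf_eq, hP, hQ]
  rw [hs]
  exact h

/-- Pull-back of a semialgebraic set along a coordinate map, in `setOf` form:
`{v | (fun j => v (θ j)) ∈ A}`. [folklore] -/
theorem _root_.Literature.ModelTheory.ExponentialFields.IsSemialgebraic.setOf_comp_mem
    {ι κ : Type*} (θ : κ → ι) {A : Set (κ → ℝ)} (hA : IsSemialgebraic k A) :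
    IsSemialgebraic k {v : ι → ℝ | (fun j => v (θ j)) ∈ A} :=
  hA.preimage_comp θ

/-- Pull-back of a semialgebraic set along three coordinate maps assembled by `Sum.elim`:
`{v | Sum.elim (v ∘ a) (Sum.elim (v ∘ b) (v ∘ d)) ∈ G}` — the form in which a family of graphs
`G ⊆ ℝ ^ (γ ⊕ (Fin n ⊕ Fin n))` is evaluated at bound variables. [folklore] -/
theorem _root_.Literature.ModelTheory.ExponentialFields.IsSemialgebraic.setOf_elim_mem
    {ι γ α β : Type*} {G : Set (γ ⊕ (α ⊕ β) → ℝ)} (hG : IsSemialgebraic k G)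
    (a : γ → ι) (b : α → ι) (d : β → ι) :
    IsSemialgebraic k
      {v : ι → ℝ | Sum.elim (fun g => v (a g)) (Sum.elim (fun i => v (b i)) (fun j => v (d j))) ∈ G} := by
  convert hG.preimage_comp (Sum.elim a (Sum.elim b d)) using 1
  ext v
  simp only [mem_setOf_eq, mem_preimage]
  congr! 1
  funext x
  rcases x with g | i | j <;> rfl

/-! ### The determinant as a polynomial in the entries -/

/-- The determinant of the `σ × σ` matrix read off a tuple through an index map `e : σ × σ → ι`
is a polynomial function over `k` of the tuple: `aeval v (rename e (det X)) = det (v ∘ e)`.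
[folklore] -/
theorem aeval_rename_det_mvPolynomialX {ι σ : Type*} [Fintype σ] [DecidableEq σ] (e : σ × σ → ι)
    (v : ι → ℝ) :
    aeval v (rename e (Matrix.mvPolynomialX σ σ k).det) =
      (Matrix.of fun i j => v (e (i, j))).det := by
  rw [aeval_rename, AlgHom.map_det]
  congr 1
  have hfun : (v ∘ e) = fun p : σ × σ => (Matrix.of fun i j : σ => v (e (i, j))) p.1 p.2 := by
    funext p
    rfl
  rw [hfun]
  exact Matrix.mvPolynomialX_mapMatrix_aeval k (Matrix.of fun i j : σ => v (e (i, j)))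

/-! ### Real semialgebraic sets are fibres of `ℚ`-semialgebraic families -/

/-- The generic polynomial with indeterminate coefficients `∑_{m ∈ supp p} C_m · X^m ∈ ℚ[C_m, X_i]`
evaluated at `(coefficients of p, x)` gives `p(x)`. [folklore] -/
theorem aeval_genericSum {ι : Type} (p : MvPolynomial ι ℝ) (x : ι → ℝ) :
    aeval (Sum.elim (fun m : ↥p.support => p.coeff m) x)
      (∑ m : ↥p.support, X (Sum.inl m) * rename Sum.inr (monomial (m : ι →₀ ℕ) (1 : ℚ)) :
        MvPolynomial (↥p.support ⊕ ι) ℚ) = aeval x p := by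
  simp only [map_sum, map_mul, aeval_X, Sum.elim_inl, aeval_rename, aeval_monomial,
    map_one, one_mul]
  change _ = eval x p
  rw [eval_eq, ← Finset.sum_coe_sort p.support]
  rfl

/-- **Real semialgebraic sets are fibres of `ℚ`-semialgebraic families.** For every
`ℝ`-semialgebraic `A ⊆ ℝ ^ ι` there are a finite type `γ`, a parameter `c ∈ ℝ ^ γ` and a
`ℚ`-semialgebraic `A' ⊆ ℝ ^ (γ ⊕ ι)` with `x ∈ A ↔ (c, x) ∈ A'`. [folklore] -/
theorem _root_.Literature.ModelTheory.ExponentialFields.IsSemialgebraic.exists_rat_family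
    {ι : Type} {A : Set (ι → ℝ)} (hA : IsSemialgebraic ℝ A) :
    ∃ (γ : Type) (_ : Fintype γ) (c : γ → ℝ) (A' : Set (γ ⊕ ι → ℝ)),
      IsSemialgebraic ℚ A' ∧ ∀ x, x ∈ A ↔ Sum.elim c x ∈ A' := by
  induction hA using BooleanSubalgebra.closure_bot_sup_induction with
  | mem s hs =>
    rcases hs with ⟨p, rfl⟩ | ⟨p, rfl⟩
    · obtain ⟨P, hP⟩ : ∃ P : MvPolynomial (↥p.support ⊕ ι) ℚ,
          ∀ x, aeval (Sum.elim (fun m : ↥p.support => p.coeff m) x) P = aeval x p :=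
        ⟨_, aeval_genericSum p⟩
      refine ⟨↥p.support, inferInstance, fun m => p.coeff m,
        {w | aeval w P = 0}, isSemialgebraic_setOf_eval_eq_zero P, fun x => ?_⟩
      simp only [mem_setOf_eq, hP]
    · obtain ⟨P, hP⟩ : ∃ P : MvPolynomial (↥p.support ⊕ ι) ℚ,
          ∀ x, aeval (Sum.elim (fun m : ↥p.support => p.coeff m) x) P = aeval x p :=
        ⟨_, aeval_genericSum p⟩
      refine ⟨↥p.support, inferInstance, fun m => p.coeff m,
        {w | 0 < aeval w P}, isSemialgebraic_setOf_eval_pos P, fun x => ?_⟩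
      simp only [mem_setOf_eq, hP]
  | bot =>
    refine ⟨PEmpty, inferInstance, PEmpty.elim, ∅, isSemialgebraic_empty, fun x => ?_⟩
    simp only [mem_empty_iff_false, iff_false]
    exact fun h => h
  | sup s _ t _ ihs iht =>
    obtain ⟨γ₁, _, c₁, A₁, hA₁, h₁⟩ := ihs
    obtain ⟨γ₂, _, c₂, A₂, hA₂, h₂⟩ := iht
    refine ⟨γ₁ ⊕ γ₂, inferInstance, Sum.elim c₁ c₂,
      {w | (fun j => w (Sum.map Sum.inl id j)) ∈ A₁} ∪ {w | (fun j => w (Sum.map Sum.inr id j)) ∈ A₂},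
      (hA₁.preimage_comp (Sum.map Sum.inl id)).union (hA₂.preimage_comp (Sum.map Sum.inr id)),
      fun x => ?_⟩
    have e₁ : (fun j => Sum.elim (Sum.elim c₁ c₂) x (Sum.map Sum.inl id j)) = Sum.elim c₁ x := by
      funext j
      rcases j with g | i <;> rfl
    have e₂ : (fun j => Sum.elim (Sum.elim c₁ c₂) x (Sum.map Sum.inr id j)) = Sum.elim c₂ x := by
      funext j
      rcases j with g | i <;> rfl
    change x ∈ s ∪ t ↔ _
    simp only [mem_union, mem_setOf_eq, e₁, e₂, h₁ x, h₂ x]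
  | compl s _ ih =>
    obtain ⟨γ, _, c, A', hA', h⟩ := ih
    refine ⟨γ, inferInstance, c, A'ᶜ, hA'.compl, fun x => ?_⟩
    rw [mem_compl_iff, mem_compl_iff, h x]

end Summit.KontsevichZagierPeriods.DefinableMoves.CircleSquaring
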